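import Summits.KontsevichZagierPeriods.KontsevichZagierPeriods.Theorems.LinRedNormalFormArrangementNormalFormStubRebaseSimpleZeroNestedDiffB
import Summits.KontsevichZagierPeriods.KontsevichZagierPeriods.Theorems.LinRedNormalFormArrangementNormalFormStubRebaseSimpleZeroNestedDiffC
import Summits.KontsevichZagierPeriods.KontsevichZagierPeriods.Theorems.LinRedNormalFormArrangementNormalFormStubRebaseSimpleZeroNestedDiffSigns

/-!
# Stub `stub_rebaseSimpleZeroTwo`, part `rebaseSimpleZero_nestedDifferent` (crux
`ArrangementNormalForm`, line `janus-bands`) — brick `NestedDiffPar`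

**The doubly letter-parallel case of the rebase of a nested pair with letters of different
`y`-slopes, UNCONDITIONALLY** (`RebaseDiff.good_par`, registered as
`rebaseSimpleZero_nestedDiffPar`). A clean nest `A(y) < tᵢ < tⱼ < B(y)` with the literal `GS 0 2`
integrand `K/((y − r)(tᵢ − cᵢ(y))(tⱼ − cⱼ(y)))` (simple base pole `r = ℓ₂`) whose bounds are
parallel to the letters of their fibres (`A ∥ cᵢ`, `B ∥ cⱼ`) and whose base cell lies on one side
of the pole is good for `GG 0 2 2`:
* `K = 0`: the integrand vanishes; common slopes: the landed common-slope case;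
* otherwise absolute convergence keeps both letter planes off the domain
  (`RebaseDiff.letter_ne_of_integrableOn`), so the three forms `tᵢ − cᵢ`, `tⱼ − cⱼ`,
  `(λⱼ − λᵢ)(y − r)` have constant signs `εᵢ, εⱼ, ε_q` on the (convex) domain
  (`RebaseDiff.exists_letter_sign`); by the SIGN TRICHOTOMY one of the three expansions is
  automatically dominated: `εᵢ ≠ ε_q` ⇒ type A (`RebaseDiff.good_typeA_of_signs`),
  `εⱼ = ε_q` ⇒ type B (`good_typeB_of_signs`), else `εᵢ = ε_q ≠ εⱼ` ⇒ type C
  (`good_typeC_of_signs`).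

References: M. Kontsevich, D. Zagier, *Periods* (2001), §1.2, rules (1a), (1b), (2).
-/

noncomputable section

open Set MeasureTheory MvPolynomial
open Literature.NumberTheory.Transcendental Literature.ModelTheory.ExponentialFields

namespace Summit.KontsevichZagierPeriods.ArrangementNormalForm.JanusBands

namespace RebaseDiff

open SeparatePos RebasePos RebaseZero RebaseNest

variable {m m' : ℕ} {i j : Fin 2}

/-- The sign of `(λⱼ − λᵢ)(y − r)` on a base cell lying on one side of the pole. -/
theorem exists_base_sign (hij : i ≠ j) (M : Fin m' → Cf) (A Bd : Cf) (Δ r : ℚ) (hΔ : Δ ≠ 0)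
    (hside : (∀ y ∈ cell M, (r : ℝ) < y) ∨ (∀ y ∈ cell M, y < (r : ℝ))) :
    ∃ ε : ℝ, (ε = 1 ∨ ε = -1) ∧ ∀ z ∈ gDom 0 2 m' M (nlo i A) (nhi j Bd), 0 < ε * ((Δ : ℝ) * (yv z - r)) := by
  have key : ∀ z ∈ gDom 0 2 m' M (nlo i A) (nhi j Bd), yv z ∈ cell M := fun z hz => ((mem_nDom hij M A Bd z).1 hz).1
  rcases hside with hs | hs <;> rcases lt_or_gt_of_ne hΔ with hD | hD
  · refine ⟨-1, Or.inr rfl, fun z hz => ?_⟩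
    have h1 := hs _ (key z hz); have h2 : (Δ : ℝ) < 0 := by exact_mod_cast hD
    nlinarith
  · refine ⟨1, Or.inl rfl, fun z hz => ?_⟩
    have h1 := hs _ (key z hz); have h2 : (0 : ℝ) < Δ := by exact_mod_cast hD
    nlinarith
  · refine ⟨1, Or.inl rfl, fun z hz => ?_⟩
    have h1 := hs _ (key z hz); have h2 : (Δ : ℝ) < 0 := by exact_mod_cast hD
    nlinarith
  · refine ⟨-1, Or.inr rfl, fun z hz => ?_⟩
    have h1 := hs _ (key z hz); have h2 : (0 : ℝ) < Δ := by exact_mod_cast hD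
    nlinarith

/-- **The doubly letter-parallel case, unconditionally.** A clean nest `A(y) < tᵢ < tⱼ < B(y)`
with the literal `GS 0 2` integrand (simple base pole `r = ℓ₂`, both fibres lettered), `A ∥ cᵢ`,
`B ∥ cⱼ`, whose base cell lies on one side of the pole, is good for `GG 0 2 2`.
[Kontsevich–Zagier 2001, §1.2, rules (1a), (1b), (2)] -/
theorem good_par (s : KZ.IntegralRep (0 + 1 + 2)) (hij : i ≠ j) (M : Fin m' → Cf) (A Bd : Cf)
    (L : Fin m → (Fin 0 → ℚ) × ℚ) (e : Fin m → ℕ) (p : MvPolynomial (Fin 0) ℚ) (ℓ₁ ℓ₂ : (Fin 0 → ℚ) × ℚ)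
    (n₁ n₂ : ℕ) (a : Fin 2 → Option Cf) (ci cj : Cf) (hi : a i = some ci) (hj : a j = some cj)
    (hA : A.1 (Fin.last 0) = ci.1 (Fin.last 0)) (hB : Bd.1 (Fin.last 0) = cj.1 (Fin.last 0))
    (h1 : n₁ = 0) (hn : n₂ = 1) (hside : (∀ y ∈ cell M, (ℓ₂.2 : ℝ) < y) ∨ (∀ y ∈ cell M, y < (ℓ₂.2 : ℝ)))
    (hbd : Bornology.IsBounded s.domain) (hdom : s.domain = gDom 0 2 m' M (nlo i A) (nhi j Bd))
    (hint : EqOn s.integrand (glit 0 2 p L e ℓ₁ ℓ₂ n₁ n₂ a) s.domain) : Good 2 (KZ.of s) := by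
  set T : BData := ⟨m, L, e, ℓ₁, ℓ₂, n₁, n₂⟩ with hT
  have hglit : glit 0 2 p L e ℓ₁ ℓ₂ n₁ n₂ a = glitB T p a := rfl
  -- common slopes: the landed case
  by_cases hΔ : ci.1 (Fin.last 0) = cj.1 (Fin.last 0)
  · refine good_any s M L e p ℓ₁ ℓ₂ a (nlo i A) (nhi j Bd) h1 hn ⟨ci.1 (Fin.last 0), fun l c hc => ?_⟩ hbd hdom hint
    rcases fin_two_eq_or hij l with rfl | rfl
    · rw [hi] at hc; cases hc; rfl
    · rw [hj] at hc; cases hc; exact hΔ.symm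
  -- vanishing base constant: the integrand vanishes
  by_cases hK : Kc T p = 0
  · refine RebaseZero.good_of_mem_relations (KZ.of_mem_relations_of_eqOn_zero s fun z hz => ?_)
    rw [hint hz, hglit, Pi.zero_apply, glitB_eq_Kc, hK, zero_mul, zero_mul]
  -- the letters are off the domain, the signs are constant
  have hIo : IntegrableOn (glitB T p a) (gDom 0 2 m' M (nlo i A) (nhi j Bd)) := by
    rw [← hdom, ← hglit]
    exact s.integrableOn.congr_fun hint (KZ.IntegralRep.measurableSet_domain_holds s)
  obtain ⟨hnei, hnej⟩ := letter_ne_of_integrableOn hij M A Bd T p a ci cj hi hj h1 hn hK hIo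
  obtain ⟨εi, hεi, hPi⟩ := exists_letter_sign hij M A Bd i ci hnei
  obtain ⟨εj, hεj, hPj⟩ := exists_letter_sign hij M A Bd j cj hnej
  obtain ⟨εq, hεq, hQq⟩ := exists_base_sign hij M A Bd (cj.1 (Fin.last 0) - ci.1 (Fin.last 0)) ℓ₂.2
    (sub_ne_zero.2 (Ne.symm hΔ)) hside
  rw [← hdom] at hnei hnej hPi hPj hQq
  have hy : ∀ z ∈ s.domain, yv z ≠ ℓ₂.2 := fun z hz => by
    have hc : yv z ∈ cell M := ((mem_nDom hij M A Bd z).1 (hdom ▸ hz)).1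
    rcases hside with hs | hs
    · exact (hs _ hc).ne'
    · exact (hs _ hc).ne
  have hQ' : ∀ z : Fin (0 + 1 + 2) → ℝ, (((ci.1 (Fin.last 0) - cj.1 (Fin.last 0) : ℚ) : ℝ)) * (yv z - ℓ₂.2) =
      -((((cj.1 (Fin.last 0) - ci.1 (Fin.last 0) : ℚ) : ℝ)) * (yv z - ℓ₂.2)) := fun z => by push_cast; ring
  -- the three types
  have useA : (∀ z ∈ s.domain, 0 ≤ εi * (tv z i - ev ci (yv z))) →
      (∀ z ∈ s.domain, εi * ((((cj.1 (Fin.last 0) - ci.1 (Fin.last 0) : ℚ) : ℝ)) * (yv z - ℓ₂.2)) ≤ 0) →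
      Good 2 (KZ.of s) := fun hP hQ =>
    good_typeA_of_signs s hij M A Bd L e p ℓ₁ ℓ₂ n₁ n₂ a ci cj hi hj hB hΔ h1 hn hbd hdom hint hnei hy εi hεi hP hQ
  have useB : (∀ z ∈ s.domain, 0 ≤ εj * (tv z j - ev cj (yv z))) →
      (∀ z ∈ s.domain, εj * ((((ci.1 (Fin.last 0) - cj.1 (Fin.last 0) : ℚ) : ℝ)) * (yv z - ℓ₂.2)) ≤ 0) →
      Good 2 (KZ.of s) := fun hP hQ =>
    good_typeB_of_signs s hij M A Bd L e p ℓ₁ ℓ₂ n₁ n₂ a ci cj hi hj hA hΔ h1 hn hbd hdom hint hnej hy εj hεj hP hQ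
  have useC : ∀ ε : ℝ, (ε = 1 ∨ ε = -1) → (∀ z ∈ s.domain, 0 ≤ ε * (tv z j - ev cj (yv z))) →
      (∀ z ∈ s.domain, ε * (tv z i - ev ci (yv z)) ≤ 0) → Good 2 (KZ.of s) := fun ε hε hP hQ =>
    good_typeC_of_signs s hij M A Bd L e p ℓ₁ ℓ₂ n₁ n₂ a ci cj hi hj hA hB h1 hn hbd hdom hint hnei hnej ε hε hP hQ
  -- the sign trichotomy
  rcases hεi with rfl | rfl <;> rcases hεj with rfl | rfl <;> rcases hεq with rfl | rfl
  all_goals first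
    | exact useA (fun z hz => (hPi z hz).le) (fun z hz => by linarith [hQq z hz])
    | exact useB (fun z hz => (hPj z hz).le) (fun z hz => by rw [hQ']; linarith [hQq z hz])
    | exact useC 1 (Or.inl rfl) (fun z hz => (hPj z hz).le) (fun z hz => by linarith [hPi z hz])
    | exact useC (-1) (Or.inr rfl) (fun z hz => (hPj z hz).le) (fun z hz => by linarith [hPi z hz])

end RebaseDiff

/-- **Registered part `rebaseSimpleZero_nestedDiffPar` of `rebaseSimpleZero_nestedDifferent` (stub
`stub_rebaseSimpleZeroTwo`, line `janus-bands`): the doubly letter-parallel case of the rebase of a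
nested pair with letters of DIFFERENT `y`-slopes, unconditionally.** A clean nest
`A(y) < tᵢ < tⱼ < B(y)` (literal `GS 0 2` datum with `n₁ = 0`, `n₂ = 1`, both fibres lettered)
whose inner lower bound is parallel to the inner letter and whose outer upper bound is parallel
to the outer letter (`A ∥ cᵢ`, `B ∥ cⱼ`), over a base cell lying on one side of the base pole
`ℓ₂.2`, is congruent modulo `KZ.relations` to the subgroup generated by the literal rebased class
`GG 0 2 2` (`RebaseDiff.good_par`: absolute convergence keeps the letters off the domain, the
three relevant forms have constant signs there, and by the sign trichotomy one of the three
dominated expansions — type A, B or C — applies). In the interval normal form `HDiff₁` of the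
assembly this is the sub-case `A` constant and `B ∥ cⱼ`. [Kontsevich–Zagier 2001, §1.2] -/
theorem rebaseSimpleZero_nestedDiffPar (m m' n₁ n₂ : ℕ) (s : KZ.IntegralRep (0 + 1 + 2)) (M : Fin m' → (Fin (0 + 1) → ℚ) × ℚ) (L : Fin m → (Fin 0 → ℚ) × ℚ) (e : Fin m → ℕ) (p : MvPolynomial (Fin 0) ℚ) (ℓ₁ ℓ₂ : (Fin 0 → ℚ) × ℚ) (a : Fin 2 → Option ((Fin (0 + 1) → ℚ) × ℚ)) (i j : Fin 2) (hij : i ≠ j) (A Bd ci cj : (Fin (0 + 1) → ℚ) × ℚ) (hi : a i = some ci) (hj : a j = some cj) (hA : A.1 (Fin.last 0) = ci.1 (Fin.last 0)) (hB : Bd.1 (Fin.last 0) = cj.1 (Fin.last 0)) (h1 : n₁ = 0) (hn : n₂ = 1) (hside : (∀ y ∈ RebaseZero.cell M, (ℓ₂.2 : ℝ) < y) ∨ (∀ y ∈ RebaseZero.cell M, y < (ℓ₂.2 : ℝ))) (hbd : Bornology.IsBounded s.domain) (hdom : s.domain = SeparatePos.gDom 0 2 m' M (RebaseNest.nlo i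 A) (RebaseNest.nhi j Bd)) (hint : EqOn s.integrand (RebasePos.glit 0 2 p L e ℓ₁ ℓ₂ n₁ n₂ a) s.domain) : ∃ c ∈ AddSubgroup.closure (SeparatePos.GGset 0 2 2), KZ.of s - c ∈ KZ.relations :=
  RebaseDiff.good_par s hij M A Bd L e p ℓ₁ ℓ₂ n₁ n₂ a ci cj hi hj hA hB h1 hn hside hbd hdom hint

end Summit.KontsevichZagierPeriods.ArrangementNormalForm.JanusBands
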